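import Literature.NumberTheory.QuadraticFields.RedeiReichardtRamifiedPrimes
import Literature.NumberTheory.QuadraticFields.RedeiReichardtDiscriminant
import Mathlib.RingTheory.Ideal.Pointwise
import Mathlib.RingTheory.IntegralClosure.IntegrallyClosed
import HarnessLib

/-!
# Principal products of ramified primes in `ℚ(√-n)`: only `(1)` and `(√-n) = ∏_{p ∣ n} 𝔭_p`

Topic `NumberTheory/QuadraticFields`, namespace `Literature.NumberTheory.QuadraticFields.RedeiReichardt`
(towards `redeiReichardt_fourTwoCard_classGroup`, Li–Ma 2008 Thm. 0.4 / Stevenhagen 1995 §2).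
Theorem-only file (no definition, no named fact).

Let `K ∋ √-n` be imaginary quadratic with ramified primes `𝔭₁, …, 𝔭_t` above the primes
`p₁, …, p_t` of `disc K` (Li–Ma Lemma 0.1), `n ∉ {1, 3}`.  **If a product `∏ 𝔭ᵢ^{eᵢ}`
(`eᵢ ∈ {0, 1}`) is principal, then `e = 0` or `eᵢ = [pᵢ ∣ n]` for all `i`**
(`eq_zero_or_eq_indicator_of_isPrincipal`): the generator `α` has `τα = ±α` for the conjugation
`τ` (each `𝔭ᵢ` is `τ`-stable, `𝓞_Kˣ = {±1}`); `τα = α` forces `α ∈ ℤ` of square-free norm, so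
`α = ±1`; `τα = -α` forces `α ∈ ℚ√-n`, so `N(α) = b²n` is square-free, `b = ±1`, `N(α) = n`.
This is the relation count behind "`#Cl_K[2] = 2^{t-1}` via the `2^t` products of ramified primes"
(Stevenhagen §2) and the kernel of the `2 : 1` parametrisation of `Cl_K[2]` used for Rédei–Reichardt.

Auxiliary: `eq_of_squarefree_of_isSquare_mul` (square-free `a, b` with `ab` a square are equal),
`exists_int_of_sq_eq_int` (a rational with integral square is an integer).

## References

* P. Stevenhagen, *Rédei-matrices and applications*, LMS LNS 215 (1995), §2. [Stevenhagen1995RedeiMatrices]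
* Y. Li, L. Ma, Acta Arith. 134 (2008), Lemma 0.1. [LiMa2008]
-/

noncomputable section

open NumberField Ideal Module
open scoped nonZeroDivisors Pointwise

namespace Literature.NumberTheory.QuadraticFields.RedeiReichardt

open Literature.NumberTheory.QuadraticFields.Quadratic

/-! ### Two arithmetic lemmas -/

/-- **Square-free numbers with square product are equal.** [folklore] -/
private theorem eq_of_squarefree_of_isSquare_mul {a b : ℕ} (ha : Squarefree a) (hb : Squarefree b)
    (h : IsSquare (a * b)) : a = b := by
  obtain ⟨k, hk⟩ := h
  have ha0 : a ≠ 0 := Squarefree.ne_zero ha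
  have hb0 : b ≠ 0 := Squarefree.ne_zero hb
  refine Nat.eq_of_factorization_eq ha0 hb0 fun q => ?_
  have hq : (a * b).factorization q = 2 * k.factorization q := by
    rw [hk, Nat.factorization_mul (by rintro rfl; simp at hk; omega) (by rintro rfl; simp at hk; omega)]
    simp [two_mul]
  rw [Nat.factorization_mul ha0 hb0, Finsupp.add_apply] at hq
  have h1 := Squarefree.natFactorization_le_one q ha
  have h2 := Squarefree.natFactorization_le_one q hb
  omega

/-- **A rational number with integral square is an integer** (`ℤ` is integrally closed). [folklore] -/
private theorem exists_int_of_sq_eq_int {k : ℚ} {N : ℤ} (h : k ^ 2 = N) : ∃ z : ℤ, (z : ℚ) = k := by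
  have hint : IsIntegral ℤ k := by
    refine ⟨Polynomial.X ^ 2 - Polynomial.C N, by monicity!, ?_⟩
    simp only [Polynomial.eval₂_sub, Polynomial.eval₂_X_pow, Polynomial.eval₂_C]
    rw [h]
    simp
  obtain ⟨z, hz⟩ := IsIntegrallyClosed.isIntegral_iff.mp hint
  exact ⟨z, by simpa using hz⟩

/-- **A rational algebraic integer of a number field is a rational integer.** [folklore] -/
private theorem exists_intCast_eq_of_coe_eq_algebraMap {K : Type*} [Field K] [NumberField K]
    {α : 𝓞 K} {a : ℚ} (h : (α : K) = algebraMap ℚ K a) : ∃ z : ℤ, α = (z : 𝓞 K) := by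
  have hint : IsIntegral ℤ (algebraMap ℚ K a) := h ▸ α.isIntegral_coe
  rw [isIntegral_algebraMap_iff (algebraMap ℚ K).injective] at hint
  obtain ⟨z, hz⟩ := IsIntegrallyClosed.isIntegral_iff.mp hint
  refine ⟨z, RingOfIntegers.coe_injective ?_⟩
  change (α : K) = (((z : ℤ) : 𝓞 K) : K)
  rw [h, ← hz]
  simp

/-! ### The setting -/

section Setup

variable {K : Type*} [Field K] [NumberField K] (h2 : finrank ℚ K = 2)
  {n : ℕ} {x : 𝓞 K} (hx : x ^ 2 = -(n : 𝓞 K))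
  {t : ℕ} {p : Fin t → ℕ} (hp : ∀ i, (p i).Prime) (hinj : Function.Injective p)
  (hprod : ∏ i, p i = if n % 4 = 1 then 2 * n else n)
  {P : Fin t → Ideal (𝓞 K)} (hP : ∀ i, P i ^ 2 = span {(p i : 𝓞 K)})

omit [NumberField K] in
include hx in
/-- `x² = -n` read in `K`. [folklore] -/
private theorem coe_sq_eq : ((x : 𝓞 K) : K) ^ 2 = -(n : K) := by
  have h := congrArg (fun y : 𝓞 K => (y : K)) hx
  simpa using h

omit [NumberField K] in
include hx hp hinj hprod in
/-- **The ramified primes exist**: each prime `pᵢ` of the tuple carries an ideal `𝔭ᵢ` with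
`𝔭ᵢ² = (pᵢ)` — `(pᵢ, √-n)` for `pᵢ ∣ n`, `(2, 1 + √-n)` for `pᵢ = 2 ∤ n`.
[cite: LiMa2008, Lemma 0.1] -/
theorem exists_sq_eq_span (i : Fin t) : ∃ Q : Ideal (𝓞 K), Q ^ 2 = span {(p i : 𝓞 K)} := by
  have hn := (squarefree_and_pos_of_prod_eq hp hinj hprod).1
  rcases dvd_or_of_prod_eq hp hprod i with h | ⟨h2i, h4⟩
  · exact ⟨_, sq_span_pair_eq_span hn hx (hp i) h⟩
  · refine ⟨span {(2 : 𝓞 K), 1 + x}, ?_⟩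
    rw [h2i, sq_span_pair_two_eq_span hx h4]

omit [NumberField K] in
include hP in
/-- `pᵢ ∈ 𝔭ᵢ`. [cite: LiMa2008, Lemma 0.1] -/
theorem natCast_mem (i : Fin t) : (p i : 𝓞 K) ∈ P i := by
  have h : (p i : 𝓞 K) ∈ P i ^ 2 := by rw [hP i]; exact mem_span_singleton_self _
  exact Ideal.pow_le_self two_ne_zero h

include h2 hp hP in
/-- **The ramified primes are stable under the conjugation**: `τ • 𝔭ᵢ = 𝔭ᵢ` for every
`τ ∈ Aut(K/ℚ)` (`τ • 𝔭ᵢ` is a prime containing `pᵢ`). [cite: Stevenhagen1995RedeiMatrices, §2] -/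
theorem smul_eq_self (τ : K ≃ₐ[ℚ] K) (i : Fin t) : τ • P i = P i := by
  haveI := isMaximal_of_sq_eq_span h2 (hp i) (hP i)
  have hprime : (τ • P i).IsPrime := Ideal.IsPrime.smul τ
  refine eq_of_sq_eq_span_of_mem h2 (hp i) (hP i) hprime ?_
  have hmem := Ideal.smul_mem_pointwise_smul τ _ _ (natCast_mem hP i)
  have hfix : τ • (p i : 𝓞 K) = p i :=
    map_natCast (MulSemiringAction.toRingHom (K ≃ₐ[ℚ] K) (𝓞 K) τ) (p i)
  rwa [hfix] at hmem

include h2 hP in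
/-- The norm of `∏ 𝔭ᵢ^{eᵢ}` is `∏ pᵢ^{eᵢ}`. [cite: Stevenhagen1995RedeiMatrices, §2] -/
theorem absNorm_prod_pow (e : Fin t → ℕ) :
    absNorm (∏ i, P i ^ e i) = ∏ i, p i ^ e i := by
  rw [map_prod]
  exact Finset.prod_congr rfl fun i _ => by rw [map_pow, absNorm_eq_of_sq_eq_span h2 (hP i)]

include hp hinj in
/-- `∏ pᵢ^{eᵢ}` with `eᵢ ≤ 1` is square-free. [cite: LiMa2008, Lemma 0.1] -/
theorem squarefree_prod_pow {e : Fin t → ℕ} (he : ∀ i, e i ≤ 1) : Squarefree (∏ i, p i ^ e i) := by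
  refine Squarefree.squarefree_of_dvd ?_ (squarefree_prod_of_injective hp hinj)
  exact Finset.prod_dvd_prod_of_dvd _ _ fun i _ => by
    rcases Nat.le_one_iff_eq_zero_or_eq_one.mp (he i) with h | h
    · rw [h, pow_zero]; exact one_dvd _
    · rw [h, pow_one]

/-! ### Principal products of ramified primes -/

include h2 hx hp hinj hprod hP in
/-- **A principal product of ramified primes is `(1)` or `(√-n)`.**  For `n ∉ {1, 3}` and
`e : Fin t → ZMod 2`: if `∏ 𝔭ᵢ^{eᵢ}` is principal then `e = 0` or `eᵢ = [pᵢ ∣ n]` for all `i`.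
Proof: a generator `α` satisfies `τα = ±α` (`τ` the conjugation; `τ`-stability of the `𝔭ᵢ`,
`𝓞_Kˣ = {±1}`); if `τα = α` then `α ∈ ℤ` has the square-free norm `∏ pᵢ^{eᵢ} = α²`, so `e = 0`;
if `τα = -α` then `α = b√-n` and `∏ pᵢ^{eᵢ} = b²n` with `b²n · n` a square, whence
`∏ pᵢ^{eᵢ} = n`. [cite: Stevenhagen1995RedeiMatrices, §2 (proof of Thm. 1)] -/
theorem eq_zero_or_eq_indicator_of_isPrincipal (hn1 : n ≠ 1) (hn3 : n ≠ 3) (e : Fin t → ZMod 2)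
    (hprinc : (∏ i, P i ^ (e i).val).IsPrincipal) :
    e = 0 ∨ e = fun i => if p i ∣ n then 1 else 0 := by
  classical
  obtain ⟨hn, hn0⟩ := squarefree_and_pos_of_prod_eq hp hinj hprod
  have hxK : ((x : 𝓞 K) : K) ^ 2 = -(n : K) := coe_sq_eq hx
  -- the generator and its norm
  set 𝔞 : Ideal (𝓞 K) := ∏ i, P i ^ (e i).val with h𝔞
  obtain ⟨α, hα⟩ : ∃ α : 𝓞 K, 𝔞 = span {α} := ⟨hprinc.generator, (Ideal.span_singleton_generator 𝔞).symm⟩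
  have hval : ∀ i, (e i).val ≤ 1 := fun i => Nat.lt_succ_iff.mp (ZMod.val_lt (e i))
  set m : ℕ := ∏ i, p i ^ (e i).val with hm
  have hmsq : Squarefree m := squarefree_prod_pow hp hinj hval
  have hm0 : m ≠ 0 := Squarefree.ne_zero hmsq
  have hnorm : absNorm (span {α}) = m := by rw [← hα, h𝔞, absNorm_prod_pow h2 hP]
  -- the conjugation
  obtain ⟨τ, hτx, hfix, hanti⟩ := exists_conj h2 hn hxK
  have hτ𝔞 : τ • 𝔞 = 𝔞 := by
    rw [h𝔞, Finset.smul_prod']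
    exact Finset.prod_congr rfl fun i _ => by rw [smul_pow', smul_eq_self h2 hp hP τ i]
  have hspan : τ • (span {α} : Ideal (𝓞 K)) = span {τ • α} := by
    rw [Ideal.pointwise_smul_def, Ideal.map_span, Set.image_singleton]
    rfl
  have hassoc : Associated (τ • α) α := by
    rw [← Ideal.span_singleton_eq_span_singleton, ← hspan, ← hα, hτ𝔞]
  obtain ⟨u, hu⟩ := hassoc
  have hτα : ((τ • α : 𝓞 K) : K) = τ (α : K) := rfl
  rcases units_eq_one_or_neg_one h2 hn hxK hn1 hn3 u with hu1 | hu1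
  · -- `τ α = α`: `α` is a rational integer
    left
    rw [hu1, mul_one] at hu
    have hfixα : τ (α : K) = α := by rw [← hτα, hu]
    obtain ⟨a, ha⟩ := hfix _ hfixα
    obtain ⟨z, hz⟩ := exists_intCast_eq_of_coe_eq_algebraMap ha.symm
    have hnormz : absNorm (span {α}) = z.natAbs ^ 2 := by
      rw [hz, absNorm_span_singleton, ← eq_intCast (algebraMap ℤ (𝓞 K)) z,
        Algebra.norm_algebraMap, NumberField.RingOfIntegers.rank, h2, Int.natAbs_pow]
    rw [hnorm] at hnormz
    -- `m = z²` is square-free, so `m = 1`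
    have hm1 : m = 1 := by
      by_contra hne
      have hz1 : z.natAbs ≠ 1 := fun h => hne (by rw [hnormz, h, one_pow])
      have := (Nat.squarefree_pow_iff hz1 two_ne_zero).mp (hnormz ▸ hmsq)
      exact absurd this.2 (by norm_num)
    -- hence every `eᵢ = 0`
    funext i
    have hi : p i ^ (e i).val = 1 := by
      have hdvd : p i ^ (e i).val ∣ m := Finset.dvd_prod_of_mem _ (Finset.mem_univ i)
      rw [hm1] at hdvd
      exact Nat.dvd_one.mp hdvd
    have hei : (e i).val = 0 := by
      rcases Nat.le_one_iff_eq_zero_or_eq_one.mp (hval i) with h | h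
      · exact h
      · rw [h, pow_one] at hi; exact absurd hi (hp i).ne_one
    exact (ZMod.val_eq_zero (e i)).mp hei
  · -- `τ α = -α`: `α = b √-n`
    right
    have hantiα : τ (α : K) = -α := by
      rw [← hτα]
      have : τ • α = -α := by
        have h := hu
        rw [hu1] at h
        linear_combination -h
      rw [this]
      rfl
    obtain ⟨b, hb⟩ := hanti _ hantiα
    -- `α² = -b² n` is a rational integer
    have hα2 : ((α ^ 2 : 𝓞 K) : K) = algebraMap ℚ K (-(b ^ 2 * n)) := by
      rw [RingOfIntegers.coe_eq_algebraMap, map_pow, ← RingOfIntegers.coe_eq_algebraMap, hb, mul_pow,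
        hxK, map_neg, map_mul, map_pow, map_natCast]
      ring
    obtain ⟨z, hz⟩ := exists_intCast_eq_of_coe_eq_algebraMap hα2
    have hzq : (z : ℚ) = -(b ^ 2 * n) := by
      have h1 : ((α ^ 2 : 𝓞 K) : K) = algebraMap ℚ K (z : ℚ) := by rw [hz]; simp
      rw [hα2] at h1
      exact ((algebraMap ℚ K).injective h1).symm
    -- norms: `m² = z²`, so `m = b² n`
    have hnorm2 : absNorm (span {α}) ^ 2 = z.natAbs ^ 2 := by
      rw [← map_pow, span_singleton_pow, hz, absNorm_span_singleton,
        ← eq_intCast (algebraMap ℤ (𝓞 K)) z, Algebra.norm_algebraMap,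
        NumberField.RingOfIntegers.rank, h2, Int.natAbs_pow]
    rw [hnorm] at hnorm2
    have hmz : (m : ℤ) = -z := by
      have h1 : m = z.natAbs := Nat.pow_left_injective (by norm_num) hnorm2
      have hz0 : z ≤ 0 := by
        have : (z : ℚ) ≤ 0 := by rw [hzq]; nlinarith [sq_nonneg b]
        exact_mod_cast this
      omega
    have hmq : (m : ℚ) = b ^ 2 * n := by
      have : ((m : ℤ) : ℚ) = -(z : ℚ) := by exact_mod_cast hmz
      push_cast at this
      rw [this, hzq, neg_neg]
    -- `m n = (b n)²` is a square, `m, n` square-free, so `m = n`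
    obtain ⟨k, hk⟩ := exists_int_of_sq_eq_int (k := b * n) (N := m * n) (by push_cast; rw [hmq]; ring)
    have hmn : m = n := by
      refine eq_of_squarefree_of_isSquare_mul hmsq hn ⟨k.natAbs, ?_⟩
      have h1 : ((m * n : ℕ) : ℤ) = k * k := by
        have : ((m * n : ℕ) : ℚ) = (k : ℚ) * k := by push_cast; rw [hk, hmq]; ring
        exact_mod_cast this
      have h3 := congrArg Int.natAbs h1
      rw [Int.natAbs_natCast, Int.natAbs_mul] at h3
      exact h3
    -- read off `e`
    funext i
    have key : p i ∣ n ↔ (e i).val = 1 := by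
      constructor
      · intro hdvd
        rw [← hmn, hm] at hdvd
        obtain ⟨j, -, hj⟩ := (Prime.dvd_finsetProd_iff (hp i).prime _).mp hdvd
        have hej : (e j).val = 1 := by
          rcases Nat.le_one_iff_eq_zero_or_eq_one.mp (hval j) with h | h
          · rw [h, pow_zero] at hj; exact absurd (Nat.dvd_one.mp hj) (hp i).ne_one
          · exact h
        rw [hej, pow_one] at hj
        have hij : i = j := hinj ((Nat.prime_dvd_prime_iff_eq (hp i) (hp j)).mp hj)
        rw [hij]; exact hej
      · intro h1
        have hdvd : p i ^ (e i).val ∣ m := Finset.dvd_prod_of_mem _ (Finset.mem_univ i)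
        rw [h1, pow_one, hmn] at hdvd
        exact hdvd
    by_cases hdvd : p i ∣ n
    · rw [if_pos hdvd]
      have h1 := key.mp hdvd
      have : e i = ((e i).val : ZMod 2) := (ZMod.natCast_zmod_val (e i)).symm
      rw [this, h1]; rfl
    · rw [if_neg hdvd]
      have h0 : (e i).val = 0 := by
        rcases Nat.le_one_iff_eq_zero_or_eq_one.mp (hval i) with h | h
        · exact h
        · exact absurd (key.mpr h) hdvd
      exact (ZMod.val_eq_zero (e i)).mp h0

end Setup

end Literature.NumberTheory.QuadraticFields.RedeiReichardt

end
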